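import Summits.BirchSwinnertonDyer.BirchSwinnertonDyer.Theorems.BiquadraticEisensteinDescentHeegnerTwistCouplingInSupplyLinnikCensusAmplifier
import Literature.NumberTheory.Sieve.ArithmeticLargeSieve
import Literature.NumberTheory.LFunctions.PrimeNumberTheoremProgressions
import HarnessLib

set_option linter.dupNamespace false -- `Summit.BirchSwinnertonDyer.BirchSwinnertonDyer.Theorems.…` (summit = sub)
set_option autoImplicit false

/-!
# Crux `HeegnerTwistCouplingInSupply` (stmt-BirchSwinnertonDyer-21381) — card `linnik-sieve-residual-census`:
# the GENERAL Linnik amplifier sieve and the general located-class prime supply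

Route `BiquadraticEisensteinDescent` (cell `pub/bsd-wall`, width seat `bsd-wall-cm-bed-w3` g19; `--supports` 21381, helper).
`…LinnikCensus.lean` (p706768) proved the card's first lemma for ONE located class (`ℓ ≡ 7 (mod 16)`, amplifier of FOUR
primes `≤ √Q`). The card's §«Two or three simultaneous located conditions» asks for the same census on the other corner doors
(`E_p`: a partner `q₀ ≡ 3 (mod 8)` with `(p/q₀) = −1` below `≍ p^{3/5}`, i.e. a SHORTER height `Q^{1/4}` and an amplifier of
EIGHT primes). This file isolates the two reusable engines, with the class, the height and the amplifier length as parameters: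

* ★ `card_le_of_nonresidue_amplifier` — **Linnik's amplifier in Montgomery's sieve**: if `P` is a set of odd primes `≤ Q`,
  `L` a set of primes `≤ y` with `y^k ≤ Q²`, `k` even, `C(#L, k) ≥ 1`, and EVERY `q ∈ L` is a non-residue modulo EVERY
  `p ∈ P`, then `#P ≤ 4Q² / C(#L, k)` (the products of `k` distinct primes of `L` form a set `A ⊆ (0, Q²]` of quadratic
  residues avoiding the `≥ p/2` classes `{h : (h/p) ≠ 1}` modulo each `p ∈ P`; tree:
  `Literature.NumberTheory.Sieve.ArithmeticLargeSieve.card_primes_le_of_forbidden_classes`, PROVED);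
* ★ `exists_card_primesMod_mul_log_ge` — **located-class supply** for any modulus `m` and unit class `a`:
  `X/(2φ(m)) ≤ #{q ≤ X prime : q ≡ a (m)} · log X` for `X ≥ X₀(m,a)` (tree PNT for progressions
  `Literature.NumberTheory.LFunctions.sum_log_prime_residue_isLittleO`, PROVED);
* `exists_const_mul_log_le` — `c · log y ≤ y` for large `y` (any real `c`).

HONEST FRAMING: support engines for RUNG-LEVEL corner censuses; the crux as stated (C⁺), its stubs and BSD are untouched;
nothing is closed. THEOREMS ONLY (no `def`).
-/

namespace Summit.BirchSwinnertonDyer.BirchSwinnertonDyer.Theorems.LinnikCensus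

open Finset
open Literature.NumberTheory.Sieve.ArithmeticLargeSieve (intRes intRes_natCast card_primes_le_of_forbidden_classes)

/-! ## Linnik's amplifier in Montgomery's sieve (general class, height and length) -/

/-- ★ **The amplifier sieve.** Let `P` be a finite set of odd primes `≤ Q` and `L` a finite set of primes `≤ y`, with
`y^k ≤ Q²`, `k` even and `C(#L, k) ≥ 1`; suppose every `q ∈ L` is a quadratic non-residue modulo every `p ∈ P`. Then
`#P ≤ 4Q² / C(#L, k)`. Proof: the `C(#L,k)` products of `k` distinct primes of `L` (distinct by unique factorisation,
`card_image_prod_powersetCard`-style) lie in `(0, Q²]` and are non-zero quadratic residues modulo each `p ∈ P` (`k` even),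
so they avoid the classes `J(p) = {h < p : (h/p) ≠ 1}`, `#J(p) ≥ p/2`; Montgomery's «few primes can have many forbidden
classes» with `τ = 1/2` gives `#P · (1/2) · C(#L,k) ≤ Q² + Q² − 1`. [cite: Montgomery1978, p. 561] -/
theorem card_le_of_nonresidue_amplifier {Q y k : ℕ} (hQ : 1 ≤ Q) (hyk : y ^ k ≤ Q ^ 2) (hk : Even k)
    (P L : Finset ℕ) (hP : ∀ p ∈ P, p.Prime ∧ p ≠ 2 ∧ p ≤ Q) (hL : ∀ q ∈ L, q.Prime ∧ q ≤ y)
    (hPL : ∀ p ∈ P, ∀ q ∈ L, jacobiSym (q : ℤ) p = -1) (hA : 1 ≤ L.card.choose k) :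
    (P.card : ℝ) ≤ 4 * (Q : ℝ) ^ 2 / (L.card.choose k : ℕ) := by
  classical
  set A := (L.powersetCard k).image (fun s => ∏ q ∈ s, q) with hAdef
  set N : Finset ℤ := A.map Nat.castEmbedding with hNdef
  -- `#A = C(#L, k)` by unique factorisation
  have hAcard : A.card = L.card.choose k := by
    rw [hAdef, Finset.card_image_of_injOn, Finset.card_powersetCard]
    intro s hs t ht hst
    have hs' : ∀ q ∈ s, q.Prime := fun q hq => (hL q ((Finset.mem_powersetCard.mp (Finset.mem_coe.mp hs)).1 hq)).1
    have ht' : ∀ q ∈ t, q.Prime := fun q hq => (hL q ((Finset.mem_powersetCard.mp (Finset.mem_coe.mp ht)).1 hq)).1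
    have hst' : ∏ q ∈ s, q = ∏ q ∈ t, q := hst
    calc s = (∏ q ∈ s, q).primeFactors := (Nat.primeFactors_prod hs').symm
      _ = (∏ q ∈ t, q).primeFactors := by rw [hst']
      _ = t := Nat.primeFactors_prod ht'
  have hNcard : N.card = A.card := Finset.card_map _
  let J : ℕ → Finset ℕ := fun p =>
    if p ∈ P then (Finset.range p).filter (fun h : ℕ => jacobiSym (h : ℤ) p ≠ 1) else ∅
  have hNsub : N ⊆ Finset.Ioc (0 : ℤ) (0 + ((Q ^ 2 : ℕ) : ℕ)) := by
    intro n hn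
    rw [hNdef, Finset.mem_map] at hn
    obtain ⟨m, hm, rfl⟩ := hn
    obtain ⟨s, hs, rfl⟩ := Finset.mem_image.mp hm
    obtain ⟨hsL, hcard⟩ := Finset.mem_powersetCard.mp hs
    have hm0 : 0 < ∏ q ∈ s, q := Finset.prod_pos fun q hq => (hL q (hsL hq)).1.pos
    have hmle : ∏ q ∈ s, q ≤ Q ^ 2 := by
      calc ∏ q ∈ s, q ≤ y ^ s.card := Finset.prod_le_pow_card s (fun q => q) y fun q hq => (hL q (hsL hq)).2
        _ = y ^ k := by rw [hcard]
        _ ≤ Q ^ 2 := hyk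
    simp only [Nat.castEmbedding_apply, Finset.mem_Ioc, zero_add]
    exact ⟨by exact_mod_cast hm0, by exact_mod_cast hmle⟩
  have hJ : ∀ p, p.Prime → p ≤ Q → J p ⊆ Finset.range p ∧ (J p).card < p := by
    intro p hp _
    by_cases hpP : p ∈ P
    · simp only [J, if_pos hpP]
      exact ⟨Finset.filter_subset _ _, card_nonResidueClasses_lt hp⟩
    · simp only [J, if_neg hpP]
      exact ⟨Finset.empty_subset _, by simp [hp.pos]⟩
  have hav : ∀ p, p.Prime → p ≤ Q → ∀ n ∈ N, intRes p n ∉ J p := by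
    intro p hp _ n hn
    rw [hNdef, Finset.mem_map] at hn
    obtain ⟨m, hm, rfl⟩ := hn
    rw [Nat.castEmbedding_apply, intRes_natCast]
    by_cases hpP : p ∈ P
    · simp only [J, if_pos hpP]
      obtain ⟨s, hs, rfl⟩ := Finset.mem_image.mp hm
      obtain ⟨hsL, hcard⟩ := Finset.mem_powersetCard.mp hs
      refine natMod_not_mem_nonResidueClasses ?_
      rw [jacobiSym_finsetProd_of_forall_eq_neg_one s (fun q hq => hPL p hpP q (hsL hq)), hcard, hk.neg_one_pow]
    · simp only [J, if_neg hpP]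
      simp
  have hτJ : ∀ p ∈ P, (1 / 2 : ℝ) * p ≤ ((J p).card : ℝ) := by
    intro p hp
    obtain ⟨hpp, hp2, -⟩ := hP p hp
    simp only [J, if_pos hp]
    have := natCast_le_two_mul_card_nonResidueClasses hpp hp2
    linarith
  have hZ : 1 ≤ N.card := by rw [hNcard, hAcard]; exact hA
  have hmain := card_primes_le_of_forbidden_classes N 0 (Q ^ 2) Q hQ J hNsub hJ hav P
    (fun p hp => ⟨(hP p hp).1, (hP p hp).2.2⟩) (τ := 1 / 2) (by norm_num) hτJ hZ
  rw [hNcard, hAcard] at hmain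
  have hApos : (0 : ℝ) < (L.card.choose k : ℕ) := by exact_mod_cast hA
  refine hmain.trans ?_
  rw [div_le_div_iff₀ (by positivity) hApos]
  push_cast
  nlinarith [hApos]

/-! ## The located-class prime supply for a general progression -/

/-- ★ **PNT lower bound for a located class** `a (mod m)` (`a` a unit): there is `X₀` with
`X/(2φ(m)) ≤ #{q ≤ X prime : q ≡ a (mod m)} · log X` for all `X ≥ X₀` (from `θ(X; m, a) = X/φ(m) + o(X)` with tolerance
`X/(2φ(m))`, tree `Literature.NumberTheory.LFunctions.sum_log_prime_residue_isLittleO`, and `log q ≤ log X` termwise).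
[cite: MontgomeryVaughan2007, Cor. 11.17] -/
theorem exists_card_primesMod_mul_log_ge (m a : ℕ) [NeZero m] (ha : IsUnit ((a : ℕ) : ZMod m)) :
    ∃ X₀ : ℕ, ∀ X : ℕ, X₀ ≤ X →
      (X : ℝ) / (2 * m.totient) ≤
        (((Finset.Icc 1 X).filter (fun q : ℕ => q.Prime ∧ q % m = a % m)).card : ℝ) * Real.log X := by
  have h := Literature.NumberTheory.LFunctions.sum_log_prime_residue_isLittleO (q := m) ha
  have hφ : (0 : ℝ) < m.totient := by exact_mod_cast Nat.totient_pos.mpr (NeZero.pos m)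
  have h1 := h.def (c := (m.totient : ℝ)⁻¹ / 2) (by positivity)
  rw [Filter.eventually_atTop] at h1
  obtain ⟨X₀, hX₀⟩ := h1
  refine ⟨X₀, fun X hX => ?_⟩
  have hb := hX₀ X hX
  rw [Real.norm_eq_abs, Real.norm_eq_abs, Nat.abs_cast] at hb
  have hb2 := (abs_sub_le_iff.mp hb).2
  have hsub : (Finset.Icc 1 X).filter (fun p : ℕ => p.Prime ∧ ((p : ℕ) : ZMod m) = ((a : ℕ) : ZMod m)) ⊆
      (Finset.Icc 1 X).filter (fun q : ℕ => q.Prime ∧ q % m = a % m) := by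
    intro p hp
    rw [Finset.mem_filter] at hp ⊢
    exact ⟨hp.1, hp.2.1, (ZMod.natCast_eq_natCast_iff' p a m).mp hp.2.2⟩
  have hlogX : 0 ≤ Real.log X := Real.log_natCast_nonneg X
  have hterm : ∀ p ∈ (Finset.Icc 1 X).filter (fun p : ℕ => p.Prime ∧ ((p : ℕ) : ZMod m) = ((a : ℕ) : ZMod m)),
      Real.log p ≤ Real.log X := by
    intro p hp
    rw [Finset.mem_filter, Finset.mem_Icc] at hp
    exact Real.log_le_log (by exact_mod_cast hp.1.1) (by exact_mod_cast hp.1.2)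
  have hX0 : (0 : ℝ) ≤ X := Nat.cast_nonneg X
  have hlow : (X : ℝ) / (2 * m.totient) ≤ ∑ p ∈ (Finset.Icc 1 X).filter
      (fun p : ℕ => p.Prime ∧ ((p : ℕ) : ZMod m) = ((a : ℕ) : ZMod m)), Real.log p := by
    have e : (X : ℝ) / (2 * m.totient) = (m.totient : ℝ)⁻¹ * X - (m.totient : ℝ)⁻¹ / 2 * X := by
      field_simp; ring
    rw [e]
    linarith
  calc (X : ℝ) / (2 * m.totient)
      ≤ ∑ p ∈ (Finset.Icc 1 X).filter
          (fun p : ℕ => p.Prime ∧ ((p : ℕ) : ZMod m) = ((a : ℕ) : ZMod m)), Real.log p := hlow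
    _ ≤ ∑ p ∈ (Finset.Icc 1 X).filter
          (fun p : ℕ => p.Prime ∧ ((p : ℕ) : ZMod m) = ((a : ℕ) : ZMod m)), Real.log X :=
        Finset.sum_le_sum hterm
    _ = (((Finset.Icc 1 X).filter
          (fun p : ℕ => p.Prime ∧ ((p : ℕ) : ZMod m) = ((a : ℕ) : ZMod m))).card : ℝ) * Real.log X := by
        rw [Finset.sum_const, nsmul_eq_mul]
    _ ≤ (((Finset.Icc 1 X).filter (fun q : ℕ => q.Prime ∧ q % m = a % m)).card : ℝ) * Real.log X :=
        mul_le_mul_of_nonneg_right (by exact_mod_cast Finset.card_le_card hsub) hlogX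

/-- **Growth lemma**: `c · log y ≤ y` for all large naturals `y`, any real `c` (`log = o(id)`, Mathlib
`Real.isLittleO_log_id_atTop`). [folklore] -/
theorem exists_const_mul_log_le (c : ℝ) : ∃ y₁ : ℕ, ∀ y : ℕ, y₁ ≤ y → c * Real.log y ≤ (y : ℝ) := by
  by_cases hc : c ≤ 0
  · refine ⟨1, fun y hy => ?_⟩
    have hlog : 0 ≤ Real.log y := Real.log_natCast_nonneg y
    have hy0 : (0 : ℝ) ≤ y := Nat.cast_nonneg y
    nlinarith
  have hc : 0 < c := lt_of_not_ge hc
  have h := Real.isLittleO_log_id_atTop.def (c := 1 / c) (by positivity)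
  rw [Filter.eventually_atTop] at h
  obtain ⟨x₁, hx₁⟩ := h
  refine ⟨⌈max x₁ 0⌉₊, fun y hy => ?_⟩
  have hyx : x₁ ≤ (y : ℝ) := (le_max_left _ _).trans ((Nat.ceil_le).mp hy)
  have hb := hx₁ (y : ℝ) hyx
  rw [id, Real.norm_eq_abs, Real.norm_eq_abs, Nat.abs_cast] at hb
  have h2 := (abs_le.mp hb).2
  have : c * Real.log y ≤ c * (1 / c * y) := mul_le_mul_of_nonneg_left h2 hc.le
  rw [← mul_assoc, mul_one_div_cancel hc.ne', one_mul] at this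
  exact this

end Summit.BirchSwinnertonDyer.BirchSwinnertonDyer.Theorems.LinnikCensus
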